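import Mathlib
import HarnessLib
import Summits.NavierStokesRegularity.NavierStokesRegularity.Theorems.TaylorModelRungThreeCertificateFormatVCoreSound

/-!
# Crux K1b-DR (stmt-NavierStokesRegularity-23954), line `taylor-model` — v3 certificate: the STANDARD CORE KIT
# (tabled coefficient boxes) and its `KitOK` (successor engine-1 g67)

The replayed checker evaluates the sparse field twin once per monomial, jet level and coordinate; the coefficient
boxes must therefore be an `O(1)` table read, not `IntervalD.ofQS2 prec (T.coefAt …)` (a list walk plus a `√2`
enclosure per call — measured: one sub-step does not finish in 400 s that way). `CertTables.coefTable T prec` encloses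
every entry of the list `coef` ONCE (an array, a top-level constant of the generated data module) and
`CertTables.coefBoxT T tbl` reads it by the `coef` index; `coefBoxOK_coefBoxT` is its soundness (`CoefBoxOK`, from
`IntervalD.mem_ofQS2` entrywise, junk entries being `0 ∈ [0,0]`). `CertTablesV.stdKit` packages table, monomial table
and the three numeric knobs (`infl`, `precV`, `L1₀`) into a `CoreKit`, and `kitOK_stdKit` discharges the closer's
hypothesis `KitOK` from the ONE replayed Boolean `T.checkCoef = true`. MODEL-lattice bookkeeping only (rung TL-M3);
nothing here is a statement about the Navier–Stokes equations.
-/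

-- the sub-problem namespace repeats the summit name by design (D-0017)
set_option linter.dupNamespace false

namespace Summit.NavierStokesRegularity.NavierStokesRegularity.Theorems.TaylorModelCert

open Literature.Analysis.FluidPDE.TaoCascade Literature.Analysis.FluidPDE.TaoCascade.TaylorChain

namespace CertTables

/-- The coefficient-box TABLE: every entry of `coef` enclosed once at precision `prec`. [folklore] -/
def coefTable (T : CertTables QS2) (prec : ℕ) : Array IntervalD := (T.coef.map (IntervalD.ofQS2 prec)).toArray

/-- Coefficient boxes READ FROM A TABLE by the `coef` index of `coefAt` (`O(1)` per monomial). [folklore] -/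
def coefBoxT {K : Type} (T : CertTables K) (tbl : Array IntervalD) : Fin 4 → Fin 4 → Fin 4 → ℕ → ℤ → IntervalD :=
  fun a b i μi k => IntervalD.aget tbl ((((a.val * 4 + b.val) * 4 + i.val) * 4 + μi) * T.m + (k + T.Kb).toNat)

/-- Every table entry encloses the corresponding coefficient (junk entries: `0 ∈ [0,0]`). [folklore] -/
theorem mem_aget_coefTable (T : CertTables QS2) (prec idx : ℕ) :
    IntervalD.mem (QS2.toRealHom (vget T.coef idx)) (IntervalD.aget (T.coefTable prec) idx) := by
  unfold coefTable IntervalD.aget vget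
  by_cases h : idx < T.coef.length
  · have hs : idx < (T.coef.map (IntervalD.ofQS2 prec)).toArray.size := by simpa using h
    rw [dif_pos hs]
    simp only [List.getElem_toArray, List.getElem_map, List.getD_eq_getElem?_getD, List.getElem?_eq_getElem h,
      Option.getD_some]
    exact IntervalD.mem_ofQS2 prec _
  · have hs : ¬ idx < (T.coef.map (IntervalD.ofQS2 prec)).toArray.size := by simpa using h
    rw [dif_neg hs, List.getD_eq_default _ _ (not_lt.1 h), map_zero]
    exact_mod_cast IntervalD.mem_ofInt 0

/-- **The tabled boxes are sound coefficient boxes.** [folklore] -/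
theorem coefBoxOK_coefBoxT (T : CertTables QS2) (prec : ℕ) : CoefBoxOK QS2.toRealHom T (T.coefBoxT (T.coefTable prec)) :=
  fun _ _ _ _ _ _ _ _ => T.mem_aget_coefTable prec _

end CertTables

namespace CertTablesV

/-- The STANDARD core kit of a v3 record: tabled boxes `tbl`, their monomial table `mt` (both computed once by the data
module), inflation exponent, `Vc` precision, first Lipschitz trial. [folklore] -/
def stdKit (TV : CertTablesV) (tbl : Array IntervalD) (mt : Array (List (ℕ × ℕ × ℕ))) (infl precV : ℕ) (L1₀ : Dyad) :
    CoreKit :=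
  { coefB := TV.base.coefBoxT tbl, mt := mt, infl := infl, precV := precV, L1₀ := L1₀ }

/-- **`KitOK` of the standard kit** from the replayed Boolean `checkCoef`. [folklore] -/
theorem kitOK_stdKit (TV : CertTablesV) (prec infl precV : ℕ) (L1₀ : Dyad) (hco : TV.base.checkCoef = true) :
    KitOK TV (fun _ => TV.stdKit (TV.base.coefTable prec)
      (TV.base.monosTable (TV.base.coefBoxT (TV.base.coefTable prec))) infl precV L1₀) :=
  ⟨TV.base.coefOK_of_checkCoef hco, fun _ => TV.base.coefBoxOK_coefBoxT prec, fun _ => rfl⟩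

end CertTablesV

end Summit.NavierStokesRegularity.NavierStokesRegularity.Theorems.TaylorModelCert
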